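import Summits.QuantumFields.QCD.Theorems.GaussianLinkFramesFrameFMClosureTwoStarOfPaddedAux1

/-!
# Crux `GaussianLinkFrames.FrameFMClosure` (stmt-QuantumFields-17375), line `pad-the-fibre`, stub
`stub_twoStarOfPadded` — helper 3: clause (T1) of `TwoStarBounds` on an ARBITRARY refit fibre avoiding the two
depletion sets, with the cofactor domination supplied PER FIBRE

Region-generic re-run of `VonMisesCirclesC1.fibre_T1` / `T1_global` (`…TwoStarC1Aux7`).  In the template the fibre
of clause (T1) is the two-star fibre of `u', v`, on which the inside factor `‖G_W(x,u)‖₁^s` (`W = ebox(x,ℓ)`) and the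
far factor `‖G_{Λᶜ}(v',y)‖₁^s` (`Λ = ebox(x,3ℓ+2)`) are constant because no star link joins two sites of `W` or two
sites of `Λᶜ`.  Here the fibre `R` is arbitrary (`#R ≤ n`) and exactly these two locality properties are the
hypotheses `hRW`, `hRΛ` (for the padded regions of this line they are what the frozen boundary layers of
`IsPadRegion` buy); the domination of the middle factor's adjugate block is the per-fibre hypothesis `hdom` (side
`univ`).  `T1_of_dom` integrates over the outside; the integrability of the reference product needs dominated regions
for the inside and far factors (`hdW`, `hdΛ`, supplied by clause (T0)).

References: Aizenman–Schenker–Friedrich–Hundertmark, CMP 224 (2001) 219, Lemmas 4–5, eq. (2.17) [AizenmanEtAl2001].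
-/

noncomputable section

open scoped BigOperators ENNReal
open MeasureTheory
open Literature.MathematicalPhysics.QuantumFieldTheory Literature.MathematicalPhysics.QuantumLattice
  Literature.Probability.LatticeModels
open Summit.QuantumFields.QCD.Theorems.VonMisesCircles Summit.QuantumFields.QCD.Theorems.VonMisesCirclesC1

namespace Summit.QuantumFields.QCD.Theorems.PadTheFibreTwoStar

section Generic

variable {Nf n : ℕ} {s₁ C₁ p₁ C₀ m₀ : ℝ}

variable (hB : ∀ (N : ℕ) [NeZero N] (R : Finset (Edge 4 N)), R.card ≤ n →
    ∀ (U : GaugeConfig 4 N (Matrix.specialUnitaryGroup (Fin 3) ℂ)) (β : ℝ)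
      (P Q : GaugeConfig 4 N (Matrix.specialUnitaryGroup (Fin 3) ℂ) → ℂ),
      IsFibrePoly (4 * Nf + 4) P → IsFibrePoly (4 * Nf + 4) Q →
      let refit : GaugeConfig 4 N (Matrix.specialUnitaryGroup (Fin 3) ℂ) →
          GaugeConfig 4 N (Matrix.specialUnitaryGroup (Fin 3) ℂ) := fun W e => if e ∈ R then W e else U e
      let wt : GaugeConfig 4 N (Matrix.specialUnitaryGroup (Fin 3) ℂ) → ℝ := fun W =>
        Real.exp (-(β * wilsonAction (fundamentalRep (Fin 3)) (refit W))) * ‖P (refit W)‖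
      let haar : Measure (GaugeConfig 4 N (Matrix.specialUnitaryGroup (Fin 3) ℂ)) :=
        Measure.pi fun _ => haarProbability (Matrix.specialUnitaryGroup (Fin 3) ℂ)
      let Z : ℝ := ∫ W, wt W ∂haar
      (∃ W, P (refit W) ≠ 0) →
        ((∃ W, Q (refit W) ≠ 0) → ∀ᵐ W ∂haar, Q (refit W) ≠ 0) ∧
        (∀ W₀ : GaugeConfig 4 N (Matrix.specialUnitaryGroup (Fin 3) ℂ),
          ‖Q (refit W₀)‖ ≤ C₁ * (1 + |β|) ^ p₁ * ((∫ W, ‖Q (refit W)‖ * wt W ∂haar) / Z)) ∧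
        (∀ s : ℝ, 0 < s → s ≤ s₁ →
          Integrable (fun W => ‖Q (refit W)‖ ^ (-s) * wt W) haar ∧
          (∫ W, ‖Q (refit W)‖ ^ (-s) * wt W ∂haar) / Z ≤
            C₁ * (1 + |β|) ^ p₁ *
              (⨆ W : GaugeConfig 4 N (Matrix.specialUnitaryGroup (Fin 3) ℂ), ‖Q (refit W)‖) ^ (-s)))
  (hC₁ : 0 < C₁) (hC₀ : 0 < C₀)

include hB hC₁ hC₀

/-- **Fibre form of (T1) on a dominated fibre avoiding the depletion sets.**  Let `R` (`#R ≤ n`) contain no link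
joining two sites of `W := ebox(x,ℓ)` and no link joining two sites of `Λᶜ` (`Λ := ebox(x,3ℓ+2)`).  Then on the
`R`-fibre the inside factor `‖G_W(x,u)‖₁^s` and the far factor `‖G_{Λᶜ}(v',y)‖₁^s` are constant, and if the `(u',v)`
adjugate block of `D` is dominated by `C₀ · sup_fibre |det D|`, the middle factor `‖D⁻¹(u',v)‖₁^s` is removed at the
cost `C₀^s C₁(1+|β|)^{p₁}` (ASFH Lemma 4 on the fibre, (2.17) conditional form). [cite: AizenmanEtAl2001, Lemma 5] -/
theorem fibre_T1_of_dom {S : ℕ} (β : ℝ) (mq : Fin Nf → ℝ) (x : TorusSite 4 (2 * S + 1)) (ℓ : ℕ)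
    (u u' v v' y : TorusSite 4 (2 * S + 1)) (R : Finset (Edge 4 (2 * S + 1))) (hRcard : R.card ≤ n)
    (hRW : ∀ e ∈ R, ¬(e.1 ∈ ebox S x ℓ ∧ Site.shift e.1 e.2 ∈ ebox S x ℓ))
    (hRΛ : ∀ e ∈ R, ¬(e.1 ∈ (ebox S x (3 * ℓ + 2))ᶜ ∧ Site.shift e.1 e.2 ∈ (ebox S x (3 * ℓ + 2))ᶜ))
    (s : ℝ) (hs : 0 < s) (hss : s ≤ s₁)
    (U : GaugeConfig 4 (2 * S + 1) (Matrix.specialUnitaryGroup (Fin 3) ℂ))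
    (hdom : ∀ W : GaugeConfig 4 (2 * S + 1) (Matrix.specialUnitaryGroup (Fin 3) ℂ),
      blockNorm ((sideMatrix Finset.univ (wilsonD (fun e => if e ∈ R then W e else U e) m₀)).adjugate) u' v ≤
        C₀ * ⨆ W' : GaugeConfig 4 (2 * S + 1) (Matrix.specialUnitaryGroup (Fin 3) ℂ),
          ‖(sideMatrix Finset.univ (wilsonD (fun e => if e ∈ R then W' e else U e) m₀)).det‖) :
    ∫⁻ W, ENNReal.ofReal (Real.exp (-(β * wilsonAction (fundamentalRep (Fin 3))
          (fun e => if e ∈ R then W e else U e))) *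
        ‖(diracMatrix (fun e => if e ∈ R then W e else U e) mq).det‖ *
        (blockNorm (gside (ebox S x ℓ) (wilsonD (fun e => if e ∈ R then W e else U e) m₀)) x u ^ s *
          blockNorm (wilsonD (fun e => if e ∈ R then W e else U e) m₀)⁻¹ u' v ^ s *
          blockNorm (gside (ebox S x (3 * ℓ + 2))ᶜ (wilsonD (fun e => if e ∈ R then W e else U e) m₀)) v' y ^ s))
      ∂(Measure.pi fun _ : Edge 4 (2 * S + 1) => haarProbability (Matrix.specialUnitaryGroup (Fin 3) ℂ)) ≤
    ENNReal.ofReal (C₀ ^ s * (C₁ * (1 + |β|) ^ p₁)) *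
      ∫⁻ W, ENNReal.ofReal (Real.exp (-(β * wilsonAction (fundamentalRep (Fin 3))
          (fun e => if e ∈ R then W e else U e))) *
        ‖(diracMatrix (fun e => if e ∈ R then W e else U e) mq).det‖ *
        (blockNorm (gside (ebox S x ℓ) (wilsonD (fun e => if e ∈ R then W e else U e) m₀)) x u ^ s *
          blockNorm (gside (ebox S x (3 * ℓ + 2))ᶜ (wilsonD (fun e => if e ∈ R then W e else U e) m₀)) v' y ^ s))
      ∂(Measure.pi fun _ : Edge 4 (2 * S + 1) => haarProbability (Matrix.specialUnitaryGroup (Fin 3) ℂ)) := by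
  -- the inside and far factors are constant on the fibre
  have hIn : ∀ W : GaugeConfig 4 (2 * S + 1) (Matrix.specialUnitaryGroup (Fin 3) ℂ),
      gside (ebox S x ℓ) (wilsonD (fun e => if e ∈ R then W e else U e) m₀) = gside (ebox S x ℓ) (wilsonD U m₀) := by
    intro W
    unfold gside
    rw [sideMatrix_wilsonD_refit_eq (ebox S x ℓ) R hRW]
  have hFar : ∀ W : GaugeConfig 4 (2 * S + 1) (Matrix.specialUnitaryGroup (Fin 3) ℂ),
      gside (ebox S x (3 * ℓ + 2))ᶜ (wilsonD (fun e => if e ∈ R then W e else U e) m₀) =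
        gside (ebox S x (3 * ℓ + 2))ᶜ (wilsonD U m₀) := by
    intro W
    unfold gside
    rw [sideMatrix_wilsonD_refit_eq (ebox S x (3 * ℓ + 2))ᶜ R hRΛ]
  simp_rw [hIn, hFar]
  -- abbreviate the constant factors
  set cI : ℝ := blockNorm (gside (ebox S x ℓ) (wilsonD U m₀)) x u ^ s with hcI
  set cF : ℝ := blockNorm (gside (ebox S x (3 * ℓ + 2))ᶜ (wilsonD U m₀)) v' y ^ s with hcF
  have hcI0 : 0 ≤ cI := Real.rpow_nonneg (blockNorm_nonneg _ _ _) _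
  have hcF0 : 0 ≤ cF := Real.rpow_nonneg (blockNorm_nonneg _ _ _) _
  have hmid := fibre_T5_inv_of_dom hB hC₁ hC₀ β mq u' v R hRcard s hs hss U hdom
  have hSm := measurable_wilsonAction (d := 4) (L := 2 * S + 1) (fundamentalRep (Fin 3))
    (continuous_fundamentalRep (Fin 3))
  have hdm := measurable_norm_det_diracMatrix (S := 2 * S + 1) mq
  have hTm := measurable_refit R U
  have hwm : Measurable fun W : GaugeConfig 4 (2 * S + 1) (Matrix.specialUnitaryGroup (Fin 3) ℂ) =>
      ENNReal.ofReal (Real.exp (-(β * wilsonAction (fundamentalRep (Fin 3)) (fun e => if e ∈ R then W e else U e))) *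
        ‖(diracMatrix (fun e => if e ∈ R then W e else U e) mq).det‖) :=
    ((Real.measurable_exp.comp ((hSm.comp hTm).const_mul β).neg).mul (hdm.comp hTm)).ennreal_ofReal
  have hMm : Measurable fun W : GaugeConfig 4 (2 * S + 1) (Matrix.specialUnitaryGroup (Fin 3) ℂ) =>
      ENNReal.ofReal (Real.exp (-(β * wilsonAction (fundamentalRep (Fin 3)) (fun e => if e ∈ R then W e else U e))) *
        ‖(diracMatrix (fun e => if e ∈ R then W e else U e) mq).det‖ *
        blockNorm (wilsonD (fun e => if e ∈ R then W e else U e) m₀)⁻¹ u' v ^ s) :=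
    (((Real.measurable_exp.comp ((hSm.comp hTm).const_mul β).neg).mul (hdm.comp hTm)).mul
      (((measurable_blockNorm_inv_wilsonD m₀ u' v).comp hTm).pow_const s)).ennreal_ofReal
  -- pull the constants out, apply the middle-factor bound, push the constants back
  have e1 : ∀ W : GaugeConfig 4 (2 * S + 1) (Matrix.specialUnitaryGroup (Fin 3) ℂ),
      ENNReal.ofReal (Real.exp (-(β * wilsonAction (fundamentalRep (Fin 3)) (fun e => if e ∈ R then W e else U e))) *
        ‖(diracMatrix (fun e => if e ∈ R then W e else U e) mq).det‖ *
        (cI * blockNorm (wilsonD (fun e => if e ∈ R then W e else U e) m₀)⁻¹ u' v ^ s * cF)) =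
      ENNReal.ofReal (cI * cF) *
        ENNReal.ofReal (Real.exp (-(β * wilsonAction (fundamentalRep (Fin 3)) (fun e => if e ∈ R then W e else U e))) *
          ‖(diracMatrix (fun e => if e ∈ R then W e else U e) mq).det‖ *
          blockNorm (wilsonD (fun e => if e ∈ R then W e else U e) m₀)⁻¹ u' v ^ s) := fun W => by
    rw [← ENNReal.ofReal_mul (mul_nonneg hcI0 hcF0)]
    congr 1
    ring
  have e2 : ∀ W : GaugeConfig 4 (2 * S + 1) (Matrix.specialUnitaryGroup (Fin 3) ℂ),
      ENNReal.ofReal (Real.exp (-(β * wilsonAction (fundamentalRep (Fin 3)) (fun e => if e ∈ R then W e else U e))) *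
        ‖(diracMatrix (fun e => if e ∈ R then W e else U e) mq).det‖ * (cI * cF)) =
      ENNReal.ofReal (cI * cF) *
        ENNReal.ofReal (Real.exp (-(β * wilsonAction (fundamentalRep (Fin 3)) (fun e => if e ∈ R then W e else U e))) *
          ‖(diracMatrix (fun e => if e ∈ R then W e else U e) mq).det‖) := fun W => by
    rw [← ENNReal.ofReal_mul (mul_nonneg hcI0 hcF0)]
    congr 1
    ring
  simp_rw [e1, e2]
  rw [lintegral_const_mul _ hMm, lintegral_const_mul _ hwm]
  calc ENNReal.ofReal (cI * cF) * ∫⁻ W, ENNReal.ofReal (Real.exp (-(β * wilsonAction (fundamentalRep (Fin 3))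
            (fun e => if e ∈ R then W e else U e))) *
          ‖(diracMatrix (fun e => if e ∈ R then W e else U e) mq).det‖ *
          blockNorm (wilsonD (fun e => if e ∈ R then W e else U e) m₀)⁻¹ u' v ^ s)
        ∂(Measure.pi fun _ : Edge 4 (2 * S + 1) => haarProbability (Matrix.specialUnitaryGroup (Fin 3) ℂ))
      ≤ ENNReal.ofReal (cI * cF) * (ENNReal.ofReal (C₀ ^ s * (C₁ * (1 + |β|) ^ p₁)) *
          ∫⁻ W, ENNReal.ofReal (Real.exp (-(β * wilsonAction (fundamentalRep (Fin 3))
            (fun e => if e ∈ R then W e else U e))) *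
          ‖(diracMatrix (fun e => if e ∈ R then W e else U e) mq).det‖)
        ∂(Measure.pi fun _ : Edge 4 (2 * S + 1) => haarProbability (Matrix.specialUnitaryGroup (Fin 3) ℂ))) := by
        gcongr
    _ = _ := by ring

/-- **Clause (T1) of `TwoStarBounds` from dominated regions** (ASFH Lemma 5 / (2.17), averaged): if some region `R` of
`≤ n` links avoids the links inside `W = ebox(x,ℓ)` and inside `Λᶜ = ebox(x,3ℓ+2)ᶜ` and dominates the `(u',v)` block of
`adj D` over every outside field, and the inside / far factors have dominated regions of their own (for the
integrability of the reference product), then for `0 < s`, `3s ≤ s₁`: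
`pqE[‖G_W(x,u)‖^s ‖D⁻¹(u',v)‖^s ‖G_{Λᶜ}(v',y)‖^s] ≤ C₀^s C₁(1+|β|)^{p₁} · pqE[‖G_W(x,u)‖^s ‖G_{Λᶜ}(v',y)‖^s]`.
[cite: AizenmanEtAl2001, Lemma 5] -/
theorem T1_of_dom {S : ℕ} (β : ℝ) (mq : Fin Nf → ℝ) (x : TorusSite 4 (2 * S + 1)) (ℓ : ℕ)
    (u u' v v' y : TorusSite 4 (2 * S + 1)) (R : Finset (Edge 4 (2 * S + 1))) (hRcard : R.card ≤ n)
    (hRW : ∀ e ∈ R, ¬(e.1 ∈ ebox S x ℓ ∧ Site.shift e.1 e.2 ∈ ebox S x ℓ))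
    (hRΛ : ∀ e ∈ R, ¬(e.1 ∈ (ebox S x (3 * ℓ + 2))ᶜ ∧ Site.shift e.1 e.2 ∈ (ebox S x (3 * ℓ + 2))ᶜ))
    (hdom : ∀ U W : GaugeConfig 4 (2 * S + 1) (Matrix.specialUnitaryGroup (Fin 3) ℂ),
      blockNorm ((sideMatrix Finset.univ (wilsonD (fun e => if e ∈ R then W e else U e) m₀)).adjugate) u' v ≤
        C₀ * ⨆ W' : GaugeConfig 4 (2 * S + 1) (Matrix.specialUnitaryGroup (Fin 3) ℂ),
          ‖(sideMatrix Finset.univ (wilsonD (fun e => if e ∈ R then W' e else U e) m₀)).det‖)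
    (hdW : x ∈ ebox S x ℓ → u ∈ ebox S x ℓ → ∃ R' : Finset (Edge 4 (2 * S + 1)), R'.card ≤ n ∧
      ∀ U W : GaugeConfig 4 (2 * S + 1) (Matrix.specialUnitaryGroup (Fin 3) ℂ),
        blockNorm ((sideMatrix (ebox S x ℓ) (wilsonD (fun e => if e ∈ R' then W e else U e) m₀)).adjugate) x u ≤
          C₀ * ⨆ W' : GaugeConfig 4 (2 * S + 1) (Matrix.specialUnitaryGroup (Fin 3) ℂ),
            ‖(sideMatrix (ebox S x ℓ) (wilsonD (fun e => if e ∈ R' then W' e else U e) m₀)).det‖)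
    (hdΛ : v' ∈ (ebox S x (3 * ℓ + 2))ᶜ → y ∈ (ebox S x (3 * ℓ + 2))ᶜ →
      ∃ R' : Finset (Edge 4 (2 * S + 1)), R'.card ≤ n ∧
      ∀ U W : GaugeConfig 4 (2 * S + 1) (Matrix.specialUnitaryGroup (Fin 3) ℂ),
        blockNorm ((sideMatrix (ebox S x (3 * ℓ + 2))ᶜ
            (wilsonD (fun e => if e ∈ R' then W e else U e) m₀)).adjugate) v' y ≤
          C₀ * ⨆ W' : GaugeConfig 4 (2 * S + 1) (Matrix.specialUnitaryGroup (Fin 3) ℂ),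
            ‖(sideMatrix (ebox S x (3 * ℓ + 2))ᶜ (wilsonD (fun e => if e ∈ R' then W' e else U e) m₀)).det‖)
    (s : ℝ) (hs : 0 < s) (hs3 : 3 * s ≤ s₁) :
    pqE Nf S β mq (fun U =>
        blockNorm (gside (ebox S x ℓ) (wilsonD U m₀)) x u ^ s *
          blockNorm (wilsonD U m₀)⁻¹ u' v ^ s *
          blockNorm (gside (ebox S x (3 * ℓ + 2))ᶜ (wilsonD U m₀)) v' y ^ s) ≤
      C₀ ^ s * (C₁ * (1 + |β|) ^ p₁) *
        pqE Nf S β mq (fun U =>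
          blockNorm (gside (ebox S x ℓ) (wilsonD U m₀)) x u ^ s *
            blockNorm (gside (ebox S x (3 * ℓ + 2))ᶜ (wilsonD U m₀)) v' y ^ s) := by
  have hss : s ≤ s₁ := by linarith
  -- integrability of the reference product (two factors, the third exponent `0`)
  have hGi : Integrable (fun U : GaugeConfig 4 (2 * S + 1) (Matrix.specialUnitaryGroup (Fin 3) ℂ) =>
      ‖(diracMatrix U mq).det‖ *
        (blockNorm (gside (ebox S x ℓ) (wilsonD U m₀)) x u ^ s *
          blockNorm (gside (ebox S x (3 * ℓ + 2))ᶜ (wilsonD U m₀)) v' y ^ s))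
      (wilsonMeasure (d := 4) (L := 2 * S + 1) (fundamentalRep (Fin 3)) β) := by
    have hs2 : 2 * s ≤ s₁ := by linarith
    have g₁ := integrable_T0_factor_of_dom hB hC₁ hC₀ β mq (ebox S x ℓ) x u hdW (2 * s) (by linarith) hs2
    have g₂ := integrable_T0_factor_of_dom hB hC₁ hC₀ β mq (ebox S x (3 * ℓ + 2))ᶜ v' y hdΛ (2 * s) (by linarith) hs2
    refine (g₁.add g₂).mono' ?_ (ae_of_all _ fun U => ?_)
    · exact ((measurable_norm_det_diracMatrix mq).mul
        (((measurable_blockNorm_gside _ m₀ x u).pow_const s).mul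
          ((measurable_blockNorm_gside _ m₀ v' y).pow_const s))).aestronglyMeasurable
    · have hX := Real.rpow_nonneg (blockNorm_nonneg (gside (ebox S x ℓ) (wilsonD U m₀)) x u) s
      have hY := Real.rpow_nonneg (blockNorm_nonneg (gside (ebox S x (3 * ℓ + 2))ᶜ (wilsonD U m₀)) v' y) s
      have hsq : blockNorm (gside (ebox S x ℓ) (wilsonD U m₀)) x u ^ s *
            blockNorm (gside (ebox S x (3 * ℓ + 2))ᶜ (wilsonD U m₀)) v' y ^ s ≤
          blockNorm (gside (ebox S x ℓ) (wilsonD U m₀)) x u ^ (2 * s) +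
            blockNorm (gside (ebox S x (3 * ℓ + 2))ᶜ (wilsonD U m₀)) v' y ^ (2 * s) := by
        rw [← rpow_sq_eq _ _ (blockNorm_nonneg _ _ _), ← rpow_sq_eq _ _ (blockNorm_nonneg _ _ _)]
        nlinarith [two_mul_le_add_sq (blockNorm (gside (ebox S x ℓ) (wilsonD U m₀)) x u ^ s)
          (blockNorm (gside (ebox S x (3 * ℓ + 2))ᶜ (wilsonD U m₀)) v' y ^ s), mul_nonneg hX hY]
      rw [Real.norm_eq_abs, abs_of_nonneg (mul_nonneg (norm_nonneg _) (mul_nonneg hX hY))]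
      simp only [Pi.add_apply]
      calc ‖(diracMatrix U mq).det‖ * (blockNorm (gside (ebox S x ℓ) (wilsonD U m₀)) x u ^ s *
            blockNorm (gside (ebox S x (3 * ℓ + 2))ᶜ (wilsonD U m₀)) v' y ^ s)
          ≤ ‖(diracMatrix U mq).det‖ * (blockNorm (gside (ebox S x ℓ) (wilsonD U m₀)) x u ^ (2 * s) +
            blockNorm (gside (ebox S x (3 * ℓ + 2))ᶜ (wilsonD U m₀)) v' y ^ (2 * s)) :=
            mul_le_mul_of_nonneg_left hsq (norm_nonneg _)
        _ = _ := by ring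
  refine pqE_le_mul_pqE_of_fibre_bound β mq _ _
    (fun U => mul_nonneg (mul_nonneg (Real.rpow_nonneg (blockNorm_nonneg _ _ _) _)
      (Real.rpow_nonneg (blockNorm_nonneg _ _ _) _)) (Real.rpow_nonneg (blockNorm_nonneg _ _ _) _))
    (fun U => mul_nonneg (Real.rpow_nonneg (blockNorm_nonneg _ _ _) _) (Real.rpow_nonneg (blockNorm_nonneg _ _ _) _))
    ((((measurable_blockNorm_gside _ m₀ x u).pow_const s).mul
      ((measurable_blockNorm_inv_wilsonD m₀ u' v).pow_const s)).mul
      ((measurable_blockNorm_gside _ m₀ v' y).pow_const s))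
    (((measurable_blockNorm_gside _ m₀ x u).pow_const s).mul ((measurable_blockNorm_gside _ m₀ v' y).pow_const s))
    hGi (mul_nonneg (Real.rpow_nonneg hC₀.le _) (mul_nonneg hC₁.le (Real.rpow_nonneg (by positivity) _))) R
    fun U => ?_
  exact fibre_T1_of_dom hB hC₁ hC₀ β mq x ℓ u u' v v' y R hRcard hRW hRΛ s hs hss U (hdom U)

end Generic

/-- **Registered helper `stub_twoStarOfPadded_aux3` of crux stmt-QuantumFields-17375** (line `pad-the-fibre`, stub
`stub_twoStarOfPadded`): clause (T1) of `TwoStarBounds` from the fibre band law at `n` links and dominated regions —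
one region of `≤ n` links avoiding the links inside `W` and inside `Λᶜ` and dominating the middle factor's adjugate
block, plus dominated regions for the inside and far factors (no K1♭). [cite: AizenmanEtAl2001, Lemma 5] -/
theorem stub_twoStarOfPadded_aux3 : ∀ (n Nf : ℕ) (C₀ : ℝ), 0 < C₀ → FibreBandLaw → ∃ s₁ K p : ℝ, 0 < s₁ ∧ 0 < K ∧ ∀ (S : ℕ) (β m₀ : ℝ) (mq : Fin Nf → ℝ) (x : TorusSite 4 (2 * S + 1)) (ℓ : ℕ) (u u' v v' y : TorusSite 4 (2 * S + 1)) (R : Finset (Edge 4 (2 * S + 1))), R.card ≤ n → (∀ e ∈ R, ¬(e.1 ∈ ebox S x ℓ ∧ Site.shift e.1 e.2 ∈ ebox S x ℓ)) → (∀ e ∈ R, ¬(e.1 ∈ (ebox S x (3 * ℓ + 2))ᶜ ∧ Site.shift e.1 e.2 ∈ (ebox S x (3 * ℓ + 2))ᶜ)) → (∀ U W : GaugeConfig 4 (2 * S + 1) (Matrix.specialUnitaryGroup (Fin 3) ℂ), blockNorm ((sideMatrix Finset.univ (wilsonD (fun e => if e ∈ R then W e else U e) m₀)).adjugate) u' v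 ≤ C₀ * ⨆ W' : GaugeConfig 4 (2 * S + 1) (Matrix.specialUnitaryGroup (Fin 3) ℂ), ‖(sideMatrix Finset.univ (wilsonD (fun e => if e ∈ R then W' e else U e) m₀)).det‖) → (x ∈ ebox S x ℓ → u ∈ ebox S x ℓ → ∃ R' : Finset (Edge 4 (2 * S + 1)), R'.card ≤ n ∧ ∀ U W : GaugeConfig 4 (2 * S + 1) (Matrix.specialUnitaryGroup (Fin 3) ℂ), blockNorm ((sideMatrix (ebox S x ℓ) (wilsonD (fun e => if e ∈ R' then W e else U e) m₀)).adjugate) x u ≤ C₀ * ⨆ W' : GaugeConfig 4 (2 * S + 1) (Matrix.specialUnitaryGroup (Fin 3) ℂ), ‖(sideMatrix (ebox S x ℓ) (wilsonD (fun e => if e ∈ R' then W' e else U e) m₀)).det‖) → (v' ∈ (ebox S x (3 * ℓ + 2))ᶜ → y ∈ (ebox S x (3 * ℓ + 2))ᶜ → ∃ R' : Finset (Edge 4 (2 * S + 1)), R'.card ≤ n ∧ ∀ U W : GaugeConfig 4 (2 * S + 1) (Matrix.specialUnitaryGroup (Fin 3) ℂ), blockNorm ((sideMatrix (ebox S x (3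 * ℓ + 2))ᶜ (wilsonD (fun e => if e ∈ R' then W e else U e) m₀)).adjugate) v' y ≤ C₀ * ⨆ W' : GaugeConfig 4 (2 * S + 1) (Matrix.specialUnitaryGroup (Fin 3) ℂ), ‖(sideMatrix (ebox S x (3 * ℓ + 2))ᶜ (wilsonD (fun e => if e ∈ R' then W' e else U e) m₀)).det‖) → ∀ (s : ℝ), 0 < s → s ≤ s₁ → pqE Nf S β mq (fun U => blockNorm (gside (ebox S x ℓ) (wilsonD U m₀)) x u ^ s * blockNorm (wilsonD U m₀)⁻¹ u' v ^ s * blockNorm (gside (ebox S x (3 * ℓ + 2))ᶜ (wilsonD U m₀)) v' y ^ s) ≤ K ^ s * (K * (1 + |β|) ^ p) * pqE Nf S β mq (fun U => blockNorm (gside (ebox S x ℓ) (wilsonD U m₀)) x u ^ s * blockNorm (gside (ebox S x (3 * ℓ + 2))ᶜ (wilsonD U m₀)) v' y ^ s) := by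
  intro n Nf C₀ hC₀ hFBL
  obtain ⟨sB, C₁, p₁, hsB, hC₁, hB⟩ := hFBL n (4 * Nf + 4)
  refine ⟨sB / 3, max C₀ C₁, p₁, by linarith, lt_max_of_lt_left hC₀, ?_⟩
  intro S β m₀ mq x ℓ u u' v v' y R hRcard hRW hRΛ hdom hdW hdΛ s hs hsle
  have hs3 : 3 * s ≤ sB := by linarith
  refine (T1_of_dom (m₀ := m₀) hB hC₁ hC₀ β mq x ℓ u u' v v' y R hRcard hRW hRΛ hdom hdW hdΛ s hs hs3).trans ?_
  refine mul_le_mul_of_nonneg_right ?_ (div_nonneg (integral_nonneg fun U => mul_nonneg (norm_nonneg _)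
    (mul_nonneg (Real.rpow_nonneg (blockNorm_nonneg _ _ _) _) (Real.rpow_nonneg (blockNorm_nonneg _ _ _) _)))
    (integral_nonneg fun _ => norm_nonneg _))
  have hB0 : 0 ≤ (1 + |β|) ^ p₁ := Real.rpow_nonneg (by positivity) _
  exact mul_le_mul (Real.rpow_le_rpow hC₀.le (le_max_left _ _) hs.le)
    (mul_le_mul_of_nonneg_right (le_max_right _ _) hB0) (mul_nonneg hC₁.le hB0)
    (Real.rpow_nonneg (hC₀.le.trans (le_max_left _ _)) _)

end Summit.QuantumFields.QCD.Theorems.PadTheFibreTwoStar
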